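import Literature.NumberTheory.Automorphic.CompactRepProjective            -- ★ `Representation.compactForm` + `compactForm_add_left` ∕ `_smul_left` ∕ `_conj_symm` ∕ `_apply_apply`, `isAdapted_formFun`, `formFun_self`
import Literature.NumberTheory.Automorphic.IrreducibleClassesUnitarizable  -- ★ `IrrClass.IsUnitarizable`, `IrrClass.isUnitarizable_mk`
import HarnessLib

/-!
# Crux `H413` — P3b pay-down «XiLocalPacketUnitary», stub (iii): SUPERCUSPIDAL WITH COMPACT CENTRE ⇒ UNITARIZABLE

Floor-0 programme P3∕P3b, cell `hodgecm-mathlib`, crux item stmt-HodgeConjecture-24833 (`HCCMUnconditional.H413`); P3b desk pay-down line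
`Cruxes/H413/Lines/F0_P3b_XiLocalPacketUnitaryPaydown.lean` (F0P3b-plan (g8), director s554 offer (Ob1)), registered stub
`stub_isUnitarizable_of_isSupercuspidal` — THIS FILE PROVES ITS TEXT VERBATIM (`isUnitarizable_of_isSupercuspidal` below), self-contained and
independent of the Lines publication.  HONEST LABEL: HC_CM is proved only modulo the printed citations until rung 0 closes; this file is a generic
lemma of smooth representation theory and discharges no printed citation by itself (clause (iii) of the letter `XiLocalPacketUnitary`
[Rogawski1990 §12.2 p. 173; Prop. 13.1.3 (d) p. 199] becomes in-house once the Lines file folds it together with the frame stub).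

THE MATHEMATICS (Bernstein–Zelevinsky 1976 §2.40–2.42 «compact representations are unitarisable»; Casselman 1995 §5.2; Bushnell–Henniart 2006
§10.1–§11.1).  Let `G` be a topological group with a compact open subgroup `K₀` and COMPACT centre, and let `κ` be an irreducible smooth complex
representation of `G` whose smooth matrix coefficients are compactly supported modulo the centre (★ `Representation.IsSupercuspidal`,
Harish-Chandra's definition) — hence compactly supported.  Pick a non-zero smooth linear form `λ₁ ∈ Ṽ` (★
`IsSmooth.exists_mem_contragredient_apply_ne_zero_of_mem_fixedPoints`).  The averaged form
`B(v, w) = ∫_G λ₁(κ(h⁻¹) v) · conj λ₁(κ(h⁻¹) w) dh` is the measure-free finite-sum integral ★ `Representation.compactForm` of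
`CompactRepProjective`; it is sesquilinear (★ `compactForm_add_left` ∕ `compactForm_smul_left` + Hermitian symmetry ★ `compactForm_conj_symm`),
`G`-invariant (★ `compactForm_apply_apply`, left invariance of the integral) and its diagonal values are integrals of `|λ₁(κ(h⁻¹) v)|² ≥ 0`
(★ `formFun_self`), positive as soon as `λ₁ v ≠ 0` (★ `IsAdapted.re_lcInt_pos`).  For an arbitrary `v ≠ 0` irreducibility gives `g` with
`λ₁(κ(g) v) ≠ 0` (the translates of `v` span `V`, so a non-zero `λ₁` cannot kill them all), and `B(v, v) = B(κ(g) v, κ(g) v) > 0` by invariance.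
Packaging `B` with its arguments swapped as a map `V →ₗ⋆[ℂ] V →ₗ[ℂ] ℂ` (conjugate-linear in the first variable, Mathlib's convention) gives ★
`Representation.IsUnitarizable κ`, and the class-level statement follows by ★ `IrrClass.ind` ∕ ★ `IrrClass.isUnitarizable_mk`.

* §1 `exists_apply_apply_ne_zero` — in an irreducible representation, a non-zero linear form does not vanish on the orbit of a non-zero vector;
  `re_compactForm_self_pos` — `0 < re B(v, v)` when `λ₁ v ≠ 0`.
* §2 `Representation.isUnitarizable_of_isSupercuspidal_of_isCompact_center` — the representation-level theorem (irreducible + smooth +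
  supercuspidal + compact open subgroup + compact centre ⇒ unitarizable).
* §3 `isUnitarizable_of_isSupercuspidal` — THE STUB TEXT: `(c : IrrClass G) (hc : c.IsSupercuspidal) : c.IsUnitarizable` under the same frame
  hypotheses.

PROOF lane (`--kind proof --supports stmt-HodgeConjecture-24833`): theorems only; no `def`, no named fact, no instance, no notation, no `sorry`;
axioms ⊆ {propext, Classical.choice, Quot.sound}.

## References
* I. N. Bernstein, A. V. Zelevinsky, *Representations of the group GL(n, F) where F is a non-archimedean local field*, Russian Math. Surveys
  31:3 (1976), §2.40–2.42 [BernsteinZelevinsky1976].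
* W. Casselman, *Introduction to the theory of admissible representations of p-adic reductive groups* (1995 notes), §5.2 [Casselman1995].
* C. J. Bushnell, G. Henniart, *The Local Langlands Conjecture for GL(2)*, Grundlehren 335 (2006), §10.1, §11.1 [BushnellHenniart2006].
* J. D. Rogawski, *Automorphic Representations of Unitary Groups in Three Variables*, Ann. of Math. Stud. 123 (1990), §12.2 p. 173 [Rogawski1990].
-/

set_option autoImplicit false
-- the mandated namespace repeats `HodgeConjecture.HodgeConjecture`, as in every `Theorems/*.lean` of this sub-problem
set_option linter.dupNamespace false

noncomputable section

open scoped ComplexConjugate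

namespace Summit.HodgeConjecture.HodgeConjecture.Cruxes.H413.F0P3bSupercuspidalUnitarizable

open Literature.NumberTheory.Automorphic Literature.NumberTheory.Automorphic.LcIntegral Representation

/-! ## §1 Two generic lemmas: orbit separation and positivity of the averaged form -/

section Generic

variable {G V : Type*} [Group G] [AddCommGroup V] [Module ℂ V] {κ : Representation ℂ G V}

/-- **Orbit separation in an irreducible representation.**  If `κ` is irreducible, `λ ≠ 0` is a linear form and `v ≠ 0`, then
`λ(κ(g) v) ≠ 0` for some `g`: otherwise `λ` kills the span of the orbit of `v`, a non-zero subrepresentation, hence all of `V`.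
(Wallach, *Real Reductive Groups I*, §1.4.6; Bushnell–Henniart 2006 §1.1.) [cite: BushnellHenniart2006, §1.1] -/
theorem exists_apply_apply_ne_zero [κ.IsIrreducible] {lam : Module.Dual ℂ V} (hlam : lam ≠ 0) {v : V} (hv : v ≠ 0) :
    ∃ g : G, lam (κ g v) ≠ 0 := by
  by_contra h
  push Not at h
  -- the span of the orbit of `v` is a subrepresentation
  let S : Subrepresentation κ :=
    ⟨Submodule.span ℂ (Set.range fun g : G => κ g v), fun g w hw => by
      induction hw using Submodule.span_induction with
      | mem _ h' =>
        obtain ⟨g', rfl⟩ := h'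
        rw [← Module.End.mul_apply, ← map_mul]
        exact Submodule.subset_span ⟨g * g', rfl⟩
      | zero => rw [map_zero]; exact Submodule.zero_mem _
      | add _ _ _ _ h₁ h₂ => rw [map_add]; exact Submodule.add_mem _ h₁ h₂
      | smul c _ _ h₁ => rw [map_smul]; exact Submodule.smul_mem _ c h₁⟩
  -- `λ` vanishes on it
  have hle : S.toSubmodule ≤ LinearMap.ker lam := Submodule.span_le.2 (by
    rintro _ ⟨g, rfl⟩
    exact h g)
  rcases IsSimpleOrder.eq_bot_or_eq_top S with hbot | htop
  · -- `S = ⊥` contradicts `v ≠ 0`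
    have hvS : v ∈ S := Submodule.subset_span ⟨1, by simp only [map_one, Module.End.one_apply]⟩
    rw [hbot, Subrepresentation.mem_bot_iff] at hvS
    exact hv hvS
  · -- `S = ⊤` contradicts `λ ≠ 0`
    refine hlam (LinearMap.ext fun w => ?_)
    have hw : w ∈ S := by rw [htop]; exact Subrepresentation.mem_top' w
    exact hle hw

variable [TopologicalSpace G] [IsTopologicalGroup G] {K₀ : Subgroup G} {lam₁ : Module.Dual ℂ V}
  (hK₀o : IsOpen (K₀ : Set G)) (hK₀c : IsCompact (K₀ : Set G)) (hsc : κ.IsSupercuspidal)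
  (hZ : IsCompact (Subgroup.center G : Set G)) (hlam₁ : lam₁ ∈ κ.contragredient)

include hK₀o hK₀c hsc hZ hlam₁ in
/-- **Positivity of the averaged form**: if `λ₁ v ≠ 0` then `re B(v, v) > 0` — the integrand `|λ₁(κ(h⁻¹) v)|²` is a non-negative real and
equals `|λ₁ v|² > 0` at `h = 1` (★ `IsAdapted.re_lcInt_pos`; compare ★ `compactForm_self_ne_zero`, which records only `≠ 0`).
(Bernstein–Zelevinsky 1976 §2.42; Casselman 1995 §5.2.) [cite: BernsteinZelevinsky1976, §2.40–2.42] -/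
theorem re_compactForm_self_pos {v : V} (hv : lam₁ v ≠ 0) : 0 < (κ.compactForm K₀ lam₁ v v).re := by
  refine (isAdapted_formFun hK₀o hK₀c hsc hZ hlam₁ v v).re_lcInt_pos (fun g => ?_) (fun g => ?_) ?_
  · rw [formFun_self, Complex.ofReal_re]
    exact Complex.normSq_nonneg _
  · rw [formFun_self, Complex.ofReal_im]
  · rw [formFun_self, Ne, Complex.ofReal_eq_zero, Complex.normSq_eq_zero, coeffFun_apply, inv_one, map_one]
    exact hv

end Generic

/-! ## §2 The representation-level theorem -/

section Rep

variable {G V : Type*} [Group G] [TopologicalSpace G] [IsTopologicalGroup G] [AddCommGroup V] [Module ℂ V]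

/-- **An irreducible smooth supercuspidal representation of a group with a compact open subgroup and compact centre is unitarizable**
(Bernstein–Zelevinsky 1976 §2.40–2.42 «finitely generated compact representations are unitarisable»; Casselman 1995 §5.2; Bushnell–Henniart 2006
§10.1–§11.1).  The invariant positive-definite Hermitian form is `(v, w) ↦ B(w, v)` with `B = ∫ λ₁(κ(h⁻¹)·) conj λ₁(κ(h⁻¹)·) dh` (★
`Representation.compactForm`) for any non-zero smooth `λ₁ ∈ Ṽ`; positivity at every `v ≠ 0` by orbit separation (`exists_apply_apply_ne_zero`)
and invariance.  Deliberate dot-notation extension of Mathlib's `Representation` namespace.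
[cite: BernsteinZelevinsky1976, §2.40–2.42] [cite: BushnellHenniart2006, §11.1] -/
theorem _root_.Representation.isUnitarizable_of_isSupercuspidal_of_isCompact_center (κ : Representation ℂ G V) [κ.IsIrreducible]
    (hκ : κ.IsSmooth) {K₀ : Subgroup G} (hK₀o : IsOpen (K₀ : Set G)) (hK₀c : IsCompact (K₀ : Set G)) (hsc : κ.IsSupercuspidal)
    (hZ : IsCompact (Subgroup.center G : Set G)) : κ.IsUnitarizable := by
  -- a non-zero vector and a smooth linear form not vanishing at it
  haveI : Nontrivial V := IsIrreducible.nontrivial κ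
  obtain ⟨v₀, hv₀0⟩ := exists_ne (0 : V)
  set K : Subgroup G := K₀ ⊓ κ.stabilizerSubgroup v₀ with hKdef
  have hKo : IsOpen (K : Set G) := hK₀o.inter (hκ v₀)
  have hKc : IsCompact (K : Set G) :=
    hK₀c.of_isClosed_subset (Subgroup.isClosed_of_isOpen _ hKo) fun g hg => hg.1
  have hvK : v₀ ∈ κ.fixedPoints K := (κ.mem_fixedPoints K v₀).2 fun g hg => hg.2
  obtain ⟨lam₁, hlam₁, -, hv₀⟩ := hκ.exists_mem_contragredient_apply_ne_zero_of_mem_fixedPoints hKo hKc hvK hv₀0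
  have hlam0 : lam₁ ≠ 0 := fun h0 => hv₀ (by rw [h0, LinearMap.zero_apply])
  -- the averaged form with swapped arguments, packaged as a sesquilinear map (conjugate-linear in the first variable)
  have hcs := fun v w => compactForm_conj_symm (K₀ := K₀) hK₀o hK₀c hsc hZ hlam₁ v w
  let B : V →ₗ⋆[ℂ] V →ₗ[ℂ] ℂ := LinearMap.mk₂'ₛₗ (starRingEnd ℂ) (RingHom.id ℂ) (fun v w => κ.compactForm K₀ lam₁ w v)
    (fun v v' w => by
      rw [hcs (v + v') w, compactForm_add_left hK₀o hK₀c hsc hZ hlam₁ v v' w, map_add, ← hcs v w, ← hcs v' w])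
    (fun c v w => by
      rw [hcs (c • v) w, compactForm_smul_left hK₀o hK₀c hsc hZ hlam₁ c v w, map_mul, ← hcs v w, smul_eq_mul])
    (fun v w w' => compactForm_add_left hK₀o hK₀c hsc hZ hlam₁ w w' v)
    (fun c v w => by rw [compactForm_smul_left hK₀o hK₀c hsc hZ hlam₁ c w v, RingHom.id_apply, smul_eq_mul])
  have hB : ∀ v w, B v w = κ.compactForm K₀ lam₁ w v := fun v w => rfl
  refine ⟨B, ⟨fun x y => ?_⟩, fun v hv => ?_, fun g v w => ?_⟩
  · -- Hermitian
    rw [hB, hB]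
    exact (hcs y x).symm
  · -- positive definite: move to a translate on which `λ₁` does not vanish
    obtain ⟨g, hg⟩ := exists_apply_apply_ne_zero (κ := κ) hlam0 hv
    rw [hB, ← compactForm_apply_apply hK₀o hK₀c hsc hZ hlam₁ g v v]
    exact re_compactForm_self_pos hK₀o hK₀c hsc hZ hlam₁ hg
  · -- invariant
    rw [hB, hB]
    exact compactForm_apply_apply hK₀o hK₀c hsc hZ hlam₁ g w v

end Rep

/-! ## §3 The stub text: classes -/

/-- **STUB (iii) of `Lines/F0_P3b_XiLocalPacketUnitaryPaydown` — supercuspidal with compact centre ⇒ unitarizable, on isomorphism classes**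
(the registered text VERBATIM): for a topological group `G` with a compact open subgroup `K₀` and compact centre, every supercuspidal class
`c ∈ Irr(G)` (★ `IrrClass.IsSupercuspidal`, Harish-Chandra's matrix-coefficient definition) is unitarizable (★ `IrrClass.IsUnitarizable`).  By ★
`IrrClass.ind` from `Representation.isUnitarizable_of_isSupercuspidal_of_isCompact_center` applied to a representative (irreducible and smooth by
the fields of ★ `SmoothIrrep`).  In print: Rogawski 1990 §12.2 p. 173 «`π_v` supercuspidal … unitary since the centre of `U(3)(E_w∕F_v)` is compact».
[cite: BernsteinZelevinsky1976, §2.40–2.42] [cite: BushnellHenniart2006, §10.1, §11.1] [cite: Rogawski1990, §12.2 p. 173] -/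
theorem isUnitarizable_of_isSupercuspidal {G : Type} [Group G] [TopologicalSpace G] [IsTopologicalGroup G]
    {K₀ : Subgroup G} (hK₀o : IsOpen (K₀ : Set G)) (hK₀c : IsCompact (K₀ : Set G))
    (hZ : IsCompact ((Subgroup.center G : Subgroup G) : Set G)) (c : IrrClass G) (hc : c.IsSupercuspidal) : c.IsUnitarizable := by
  induction c using IrrClass.ind with
  | h r =>
    rw [IrrClass.isSupercuspidal_mk] at hc
    exact (IrrClass.isUnitarizable_mk r).2
      (r.ρ.isUnitarizable_of_isSupercuspidal_of_isCompact_center r.isSmooth hK₀o hK₀c hc hZ)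

end Summit.HodgeConjecture.HodgeConjecture.Cruxes.H413.F0P3bSupercuspidalUnitarizable

end
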